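import Summits.QuantumAdvantage.QuantumAdvantage.Theorems.AbsorptionDialFA

/-! # AbsorptionDialF — part 2/2 (mechanical split for landing of `AbsorptionDialF`; content verbatim; scopes re-opened with their variables) -/

set_option linter.dupNamespace false
open Finset
open Literature.Computability.MetaComplexity Literature.Computability.MetaComplexity.Smolensky
open Summit.QuantumAdvantage.AdviceFreeQNC0

namespace Summit.QuantumAdvantage.QuantumAdvantage.Theorems.AbsorptionDial

section Cube
variable {n : ℕ}

/-- the exact criterion: `HasDegF p f D ↔ p ∣ c_S(f)` for all `|S| > D`. -/
theorem hasDegF_iff_dvd_cZ {p : ℕ} [Fact p.Prime] (f : (Fin n → Bool) → Bool) (D : ℕ) :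
    HasDegF p f D ↔ ∀ S : Finset (Fin n), D < S.card → (p : ℤ) ∣ cZ f S := by
  refine ⟨fun hf S hS => dvd_cZ_of_hasDegF hf hS, fun h => ?_⟩
  exact ind_mem_lowDeg_of_cZ fun S hS => (ZMod.intCast_zmod_eq_zero_iff_dvd _ _).2 (h S hS)

/-- the `𝔽₂` version: `HasDeg f D ↔ 2 ∣ c_S(f)` for all `|S| > D`. -/
theorem hasDeg_iff_dvd_cZ (f : (Fin n → Bool) → Bool) (D : ℕ) :
    HasDeg f D ↔ ∀ S : Finset (Fin n), D < S.card → (2 : ℤ) ∣ cZ f S := by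
  haveI : Fact (Nat.Prime 2) := ⟨Nat.prime_two⟩
  exact hasDegF_iff_dvd_cZ (p := 2) f D

/-- integer degree `≤ D` (all coefficients above `D` vanish) gives degree `≤ D` over every prime field. -/
theorem hasDeg_of_cZ_eq_zero {f : (Fin n → Bool) → Bool} {D : ℕ}
    (h : ∀ S : Finset (Fin n), D < S.card → cZ f S = 0) : HasDeg f D :=
  (hasDeg_iff_dvd_cZ f D).2 fun S hS => by simp [h S hS]

end Cube


/-! ### The degree-two transfer: coefficients above degree two divisible by `N ≥ 5` vanish -/

section Core

variable {n : ℕ}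

/-- linear form: for `w` vanishing on sets of size `≥ 3` and `a ∉ Y`,
`Σ_{T ⊆ Y} w(T ∪ {a}) = w{a} + Σ_{j ∈ Y} w{a, j}`. -/
theorem sum_powerset_insert_of_trunc (w : Finset (Fin n) → ℤ) (hw : ∀ T, 3 ≤ T.card → w T = 0)
    {a : Fin n} {Y : Finset (Fin n)} (ha : a ∉ Y) :
    ∑ T ∈ Y.powerset, w (insert a T) = w {a} + ∑ j ∈ Y, w {a, j} := by
  induction Y using Finset.induction_on with
  | empty => simp
  | insert l Y hl ih =>
    have hal : a ≠ l := fun h => ha (h ▸ Finset.mem_insert_self l Y)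
    have haY : a ∉ Y := fun h => ha (Finset.mem_insert_of_mem h)
    rw [Finset.sum_powerset_insert hl, ih haY, Finset.sum_insert hl]
    have h2 : ∑ T ∈ Y.powerset, w (insert a (insert l T)) = w {a, l} := by
      rw [Finset.sum_eq_single_of_mem ∅ (Finset.empty_mem_powerset Y)]
      · rw [Finset.insert_empty]
      · intro T hT hne
        apply hw
        have hlT : l ∉ T := fun h => hl (Finset.mem_powerset.1 hT h)
        have haT : a ∉ insert l T := by
          rw [Finset.mem_insert]
          rintro (h | h)
          · exact hal h
          · exact haY (Finset.mem_powerset.1 hT h)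
        rw [Finset.card_insert_of_notMem haT, Finset.card_insert_of_notMem hlT]
        have : 0 < T.card := Finset.card_pos.2 (Finset.nonempty_iff_ne_empty.2 hne)
        omega
    rw [h2]
    ring

/-- **degree-two transfer (integer form)**: if an integer `N ≥ 5` divides every coefficient `c_S(f)`,
`|S| ≥ 3`, of a Boolean `f`, then all these coefficients vanish.  (Sharp: for `N = 3`, `MOD₃` of three bits
has `c_{123} = -3`; for `N = 4` the transfer also holds but is not needed here.)
Proof: strong induction on `S`; on the cube `S` the truncated quadratic part `Q` agrees with `f` below the
top, the difference `L(Y) = Q(Y ∪ k₀) − Q(Y)` is affine in `Y ⊆ S ∖ k₀` with values in `{−1,0,1}` below the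
top, which forces `|L(S ∖ k₀)| ≤ 3`, whence `|c_S| ≤ 4 < 5`. -/
theorem cZ_eq_zero_of_dvd (f : (Fin n → Bool) → Bool) (N : ℤ) (hN : 5 ≤ N)
    (hdiv : ∀ S : Finset (Fin n), 3 ≤ S.card → N ∣ cZ f S) :
    ∀ S : Finset (Fin n), 3 ≤ S.card → cZ f S = 0 := by
  intro S
  induction S using Finset.strongInduction with
  | H S ih =>
    intro hS3
    -- truncated coefficients: agree with `cZ f` on proper subsets of `S`, vanish at size `≥ 3`
    set w : Finset (Fin n) → ℤ := fun T => if T.card ≤ 2 then cZ f T else 0 with hw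
    have hw3 : ∀ T, 3 ≤ T.card → w T = 0 := fun T hT => by
      simp [hw, show ¬ T.card ≤ 2 by omega]
    have hwT : ∀ T, T ⊂ S → w T = cZ f T := by
      intro T hT
      by_cases hc : T.card ≤ 2
      · simp [hw, hc]
      · rw [ih T hT (by omega)]
        simp [hw, hc]
    -- `Q(X) := Σ_{T ⊆ X} w T` is `f(1_X)` for `X ⊂ S` and `f(1_S) − c_S` at `X = S`
    have hQ : ∀ X, X ⊂ S → ∑ T ∈ X.powerset, w T = fv f X := by
      intro X hX
      rw [← sum_cZ]
      exact Finset.sum_congr rfl fun T hT =>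
        hwT T (Finset.ssubset_of_subset_of_ssubset (Finset.mem_powerset.1 hT) hX)
    have hQS : ∑ T ∈ S.powerset, w T = fv f S - cZ f S := by
      have hS : S ∈ S.powerset := Finset.mem_powerset.2 subset_rfl
      rw [← sum_cZ, ← Finset.add_sum_erase _ _ hS, ← Finset.add_sum_erase _ _ hS, hw3 S hS3]
      have : ∑ T ∈ S.powerset.erase S, w T = ∑ T ∈ S.powerset.erase S, cZ f T :=
        Finset.sum_congr rfl fun T hT => by
          obtain ⟨hne, hT'⟩ := Finset.mem_erase.1 hT
          exact hwT T (Finset.ssubset_iff_subset_ne.2 ⟨Finset.mem_powerset.1 hT', hne⟩)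
      rw [this]
      ring
    -- pick `k₀ ∈ S`, `S' = S ∖ k₀`
    obtain ⟨k₀, hk₀⟩ : S.Nonempty := Finset.card_pos.1 (by omega)
    set S' := S.erase k₀ with hS'
    have hk₀S' : k₀ ∉ S' := Finset.notMem_erase k₀ S
    have hSS' : insert k₀ S' = S := Finset.insert_erase hk₀
    have hcS' : S'.card = S.card - 1 := Finset.card_erase_of_mem hk₀
    have hS'S : S' ⊂ S := Finset.erase_ssubset hk₀
    obtain ⟨b, hb⟩ : ∃ b : ℤ, b = w {k₀} := ⟨_, rfl⟩
    obtain ⟨e, he⟩ : ∃ e : Fin n → ℤ, ∀ j, e j = w {k₀, j} := ⟨_, fun _ => rfl⟩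
    -- the affine form `L(Y) = b + Σ_{j ∈ Y} e j`
    have hL : ∀ Y, Y ⊆ S' →
        (∑ T ∈ (insert k₀ Y).powerset, w T) - (∑ T ∈ Y.powerset, w T) = b + ∑ j ∈ Y, e j := by
      intro Y hY
      have hkY : k₀ ∉ Y := fun h => hk₀S' (hY h)
      rw [Finset.sum_powerset_insert hkY, sum_powerset_insert_of_trunc w hw3 hkY, ← hb]
      simp only [← he]
      ring
    -- below the top: for `Y ⊆ S'`, `Y ≠ S'`, `L(Y) = f(1_{Y ∪ k₀}) − f(1_Y) ∈ [−1, 1]`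
    have hV : ∀ Y, Y ⊆ S' → Y ≠ S' → -1 ≤ b + (∑ j ∈ Y, e j) ∧ b + (∑ j ∈ Y, e j) ≤ 1 := by
      intro Y hY hne
      have hkY : k₀ ∉ Y := fun h => hk₀S' (hY h)
      have hYS : Y ⊂ S := Finset.ssubset_of_subset_of_ssubset hY hS'S
      have hkYS : insert k₀ Y ⊂ S := by
        refine Finset.ssubset_iff_subset_ne.2 ⟨Finset.insert_subset hk₀ (hY.trans hS'S.1), fun h => hne ?_⟩
        have := congrArg (fun Z => Z.erase k₀) h
        simpa [Finset.erase_insert hkY] using this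
      rw [← hL Y hY, hQ _ hkYS, hQ _ hYS]
      have := fv_nonneg f (insert k₀ Y); have := fv_le_one f (insert k₀ Y)
      have := fv_nonneg f Y; have := fv_le_one f Y
      constructor <;> linarith
    -- at the top: `c_S = f(1_S) − f(1_{S'}) − L(S')`
    have htop : cZ f S = fv f S - fv f S' - (b + ∑ j ∈ S', e j) := by
      have h1 := hL S' subset_rfl
      rw [hSS', hQS, hQ S' hS'S] at h1
      linarith
    -- the single / pair / triple constraints
    have hS'2 : 2 ≤ S'.card := by omega
    have hb1 : -1 ≤ b ∧ b ≤ 1 := by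
      have := hV ∅ (Finset.empty_subset _) (fun h => by rw [← h] at hS'2; simp at hS'2)
      simpa using this
    have hbe : ∀ j ∈ S', -1 ≤ b + e j ∧ b + e j ≤ 1 := by
      intro j hj
      have := hV {j} (Finset.singleton_subset_iff.2 hj) (fun h => by rw [← h] at hS'2; simp at hS'2)
      simpa using this
    have hpair : 4 ≤ S.card → ∀ j ∈ S', ∀ l ∈ S', j ≠ l →
        -1 ≤ b + e j + e l ∧ b + e j + e l ≤ 1 := by
      intro h4 j hj l hl hjl
      have := hV {j, l} (Finset.insert_subset hj (Finset.singleton_subset_iff.2 hl))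
        (fun h => by rw [← h, Finset.card_pair hjl] at hcS'; omega)
      rw [Finset.sum_pair hjl] at this
      constructor <;> linarith [this.1, this.2]
    have htriple : 5 ≤ S.card → ∀ j ∈ S', ∀ l ∈ S', ∀ r ∈ S', j ≠ l → j ≠ r → l ≠ r →
        -1 ≤ b + e j + e l + e r ∧ b + e j + e l + e r ≤ 1 := by
      intro h5 j hj l hl r hr hjl hjr hlr
      have hsub : ({j, l, r} : Finset (Fin n)) ⊆ S' := by
        intro x hx
        simp only [Finset.mem_insert, Finset.mem_singleton] at hx
        rcases hx with rfl | rfl | rfl <;> assumption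
      have h3 : ({j, l, r} : Finset (Fin n)).card = 3 := Finset.card_eq_three.2 ⟨j, l, r, hjl, hjr, hlr, rfl⟩
      have := hV {j, l, r} hsub (fun h => by rw [← h, h3] at hcS'; omega)
      have hjlr : j ∉ ({l, r} : Finset (Fin n)) := by simp [hjl, hjr]
      rw [Finset.sum_insert hjlr, Finset.sum_pair hlr] at this
      constructor <;> linarith [this.1, this.2]
    -- the bound `|L(S')| ≤ 3`
    have hbound : -3 ≤ b + (∑ j ∈ S', e j) ∧ b + (∑ j ∈ S', e j) ≤ 3 := by
      set P := S'.filter (fun j => e j ≠ 0) with hP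
      have hPS' : P ⊆ S' := Finset.filter_subset _ _
      have hsum : ∑ j ∈ S', e j = ∑ j ∈ P, e j := (Finset.sum_filter_ne_zero S').symm
      rw [hsum]
      have hPe : ∀ j ∈ P, e j ≠ 0 := fun j hj => (Finset.mem_filter.1 hj).2
      have hPc : P.card ≤ S'.card := Finset.card_le_card hPS'
      rcases Nat.lt_or_ge 2 P.card with h3 | h2
      · -- `|P| ≥ 3`: pairs available (`|S| ≥ 4`)
        obtain ⟨j, hj, l, hl, r, hr, hjl, hjr, hlr⟩ := Finset.two_lt_card.1 h3
        have h4 : 4 ≤ S.card := by omega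
        have pjl := hpair h4 j (hPS' hj) l (hPS' hl) hjl
        have pjr := hpair h4 j (hPS' hj) r (hPS' hr) hjr
        have plr := hpair h4 l (hPS' hl) r (hPS' hr) hlr
        have sj := hbe j (hPS' hj); have sl := hbe l (hPS' hl); have sr := hbe r (hPS' hr)
        have ej := hPe j hj; have el := hPe l hl; have er := hPe r hr
        rcases Nat.lt_or_ge 4 S.card with h5 | h4'
        · exfalso
          have t := htriple h5 j (hPS' hj) l (hPS' hl) r (hPS' hr) hjl hjr hlr
          omega
        · -- `|S| = 4`: `P = {j, l, r}`
          have hPc3 : P.card = 3 := by omega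
          have hPeq : P = {j, l, r} := by
            symm
            apply Finset.eq_of_subset_of_card_le
            · intro x hx
              simp only [Finset.mem_insert, Finset.mem_singleton] at hx
              rcases hx with rfl | rfl | rfl <;> assumption
            · rw [hPc3, Finset.card_eq_three.2 ⟨j, l, r, hjl, hjr, hlr, rfl⟩]
          have hjlr : j ∉ ({l, r} : Finset (Fin n)) := by simp [hjl, hjr]
          rw [hPeq, Finset.sum_insert hjlr, Finset.sum_pair hlr]
          omega
      · rcases Nat.lt_or_ge 1 P.card with h2' | h1
        · -- `|P| = 2`
          obtain ⟨j, l, hjl, hPeq⟩ := Finset.card_eq_two.1 (show P.card = 2 by omega)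
          have hj : j ∈ P := by simp [hPeq]
          have hl : l ∈ P := by simp [hPeq]
          rw [hPeq, Finset.sum_pair hjl]
          rcases Nat.lt_or_ge 3 S.card with h4 | h3'
          · have := hpair h4 j (hPS' hj) l (hPS' hl) hjl
            omega
          · have sj := hbe j (hPS' hj); have sl := hbe l (hPS' hl)
            omega
        · rcases Nat.lt_or_ge 0 P.card with h1' | h0
          · obtain ⟨j, hPeq⟩ := Finset.card_eq_one.1 (show P.card = 1 by omega)
            have hj : j ∈ P := by simp [hPeq]
            rw [hPeq, Finset.sum_singleton]
            have := hbe j (hPS' hj)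
            omega
          · have hP0 : P = ∅ := Finset.card_eq_zero.1 (show P.card = 0 by omega)
            rw [hP0, Finset.sum_empty]
            omega
    -- conclusion: `|c_S| ≤ 4 < 5 ≤ N` and `N ∣ c_S`
    have h1 := fv_nonneg f S; have h2 := fv_le_one f S; have h3 := fv_nonneg f S'; have h4 := fv_le_one f S'
    have habs : (cZ f S).natAbs < N.natAbs := by omega
    exact Int.eq_zero_of_dvd_of_natAbs_lt_natAbs (hdiv S hS3) habs

/-- **degree-two transfer**: for a prime `p ≥ 5`, a Boolean function of `𝔽_p`-degree `≤ 2` has all integer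
multilinear coefficients above degree two equal to zero … -/
theorem cZ_eq_zero_of_hasDegF_two {p : ℕ} [Fact p.Prime] (hp : 5 ≤ p) {f : (Fin n → Bool) → Bool}
    (hf : HasDegF p f 2) : ∀ S : Finset (Fin n), 3 ≤ S.card → cZ f S = 0 :=
  cZ_eq_zero_of_dvd f p (by exact_mod_cast hp) fun S hS => dvd_cZ_of_hasDegF hf hS

/-- … hence `𝔽₂`-degree `≤ 2` (false at `p = 3`: `MOD₃` of three bits), … -/
theorem hasDeg_two_of_hasDegF_two {p : ℕ} [Fact p.Prime] (hp : 5 ≤ p) {f : (Fin n → Bool) → Bool}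
    (hf : HasDegF p f 2) : HasDeg f 2 :=
  hasDeg_of_cZ_eq_zero (cZ_eq_zero_of_hasDegF_two hp hf)

/-- … and degree `≤ 2` over every prime field. -/
theorem hasDegF_two_transfer {p q : ℕ} [Fact p.Prime] [Fact q.Prime] (hp : 5 ≤ p)
    {f : (Fin n → Bool) → Bool} (hf : HasDegF p f 2) : HasDegF q f 2 :=
  (hasDegF_iff_dvd_cZ f 2).2 fun S hS => by simp [cZ_eq_zero_of_hasDegF_two hp hf S hS]

end Core

/-! ### The degree-two fail floor for `p ≥ 5`, and the contrast at `p = 3` -/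

/-- **degree-two fail floor**: for a prime `p ≥ 5` and `n ≥ 7`, every strategy vector of `𝔽_p`-cut-degree
`≤ 2` loses the u-walk game on at least `2^{n−7}` inputs, for every charge `c` (transfer to `𝔽₂`-degree 2 and
the `𝔽₂` cell's `WalkFailFloor.ringWinU_fail_floor`). -/
theorem degTwo_fail_floor {p : ℕ} [Fact p.Prime] (hp : 5 ≤ p) {n : ℕ} (hn : 7 ≤ n) (c : ℕ)
    (y : Fin (n + 1) → (Fin n → Bool) → Bool) (hy : ∀ g, HasDegF p (y g) 2) :
    2 ^ (n - 7) ≤ (Finset.univ.filter fun u : Fin n → Bool => ringWinU c y u = false).card := by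
  simpa using ringWinU_fail_floor 2 (by omega) c y fun g => hasDeg_two_of_hasDegF_two hp (hy g)

/-- so at most `2^n − 2^{n−7}` winners. -/
theorem degTwo_win_le {p : ℕ} [Fact p.Prime] (hp : 5 ≤ p) {n : ℕ} (hn : 7 ≤ n) (c : ℕ)
    (y : Fin (n + 1) → (Fin n → Bool) → Bool) (hy : ∀ g, HasDegF p (y g) 2) :
    (Finset.univ.filter fun u : Fin n → Bool => ringWinU c y u = true).card ≤ 2 ^ n - 2 ^ (n - 7) := by
  have hsum := Finset.card_filter_add_card_filter_not (s := (Finset.univ : Finset (Fin n → Bool)))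
    (fun u => ringWinU c y u = true)
  have hfl := degTwo_fail_floor hp hn c y hy
  have huniv : (Finset.univ : Finset (Fin n → Bool)).card = 2 ^ n := by simp
  have hnot : (Finset.univ.filter fun u : Fin n → Bool => ¬ ringWinU c y u = true).card =
      (Finset.univ.filter fun u : Fin n → Bool => ringWinU c y u = false).card := by
    congr 1; ext u; simp
  omega

/-- **contrast at `p = 3`**: there cut degree two is PERFECT for every charge and every `n ≥ 1`
(`OddPrimeWitnesses.walkEasyThree`), so neither the transfer nor the floor extends to `p = 3`. -/
theorem degTwo_perfect_three (c n : ℕ) (hn : 1 ≤ n) :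
    ∃ y : Fin (n + 1) → (Fin n → Bool) → Bool, (∀ g, HasDegF 3 (y g) 2) ∧ ∀ u, ringWinU c y u = true :=
  walkEasyThree c n hn

end Summit.QuantumAdvantage.QuantumAdvantage.Theorems.AbsorptionDial
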